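import Summits.BirchSwinnertonDyer.BirchSwinnertonDyer.Theorems.SignedLowerHalvesSmallImageLowerHalfBothSignsRttD2SeqJ3HLayerPT
import HarnessLib

/-!
# Route `SignedLowerHalves`, crux L `SmallImageLowerHalfBothSigns` (stmt-BirchSwinnertonDyer-23599), line `rtt_w3` v24 — stub S3β (`stub_junctionPT_ns`), brick T3-finite:
# POITOU–TATE EXISTENCE AT THE DEPLETED PLACES `S₀` FOR THE COINDUCED MODULE `Maps(Γ_K ⧸ U, X)` — every family of SEMILOCAL classes `(t_w)_{w∈S₀}`,
# `t_w ∈ H¹(K_w, Maps(Γ_K ⧸ U, X))`, orthogonal (sum of the canonical local Tate pairings) to the dual classes that are STRICT at `v` and unramified off `S₀ ∪ {v}`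
# IS the semilocalisation of a global layer class `y ∈ H¹(U, X)` unramified off `S₀ ∪ {v}`

WIDTH seat `bsd-line-slh-p3-w3` g25 under LEAD `cruxlead-stmt-BirchSwinnertonDyer-23599` g13 (cell `bsd-ssimc`); helper `--supports stmt-BirchSwinnertonDyer-23599`
(design memo `Lines/rtt_w3-DESIGN-S3beta-w3-g25.md`, §1 (d), finite level). THEOREMS ONLY (no definition, no named fact, no instance, no `sorry`). The MULTI-PLACE twin of g23's
H4 `exists_layer_localPairingSubgroup_eq` (one-place lift, roles reversed): here the Selmer structures are `𝓖 = (everything at S₀ ∪ {v}, unramified elsewhere)` and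
`𝓕 = (0 at S₀, everything at v, unramified elsewhere)`, so the dual Selmer group `H¹_{𝓕*}(K, Maps(Γ_K ⧸ U, X)^D)` consists of the dual classes STRICT AT `v`, free at `S₀`, and
clause (i) of the tree's `SelmerComplement` for THE canonical invariant maps (Milne I 4.10 (b) `⊇`, `PoitouTateReduction.selmerComplement_canonical_holds`) produces a global class of
`H¹_𝓖` with PRESCRIBED localisations at `S₀`. With COINDUCED coefficients no orbit/Mackey bookkeeping and no «one place above» hypothesis is needed (contrast H4). This is the
finite-level input of the Poitou–Tate EXISTENCE half in the tower behind S3β (the compact five-term sequence `B′ ↪ I.H → ⊕_{w∈S₀K} 𝐇¹_{Iw,w} → coker gX ↠ Y′`).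
HONEST FRAMING: nothing about S3β, E2, crux L or BSD is proved; all remain OPEN and are proved for NO curve.

* ★★★ `exists_layer_forall_localization_shapiroLift_eq` — for `t : w ↦ H¹(K_w, Maps(Γ_K ⧸ U, X))` with `Σ_{w∈S₀} ⟨t_w, loc_w (Ψ Sh c)⟩_w = 0` for every `c ∈ H¹(U, A)` unramified off
  `S₀ ∪ {v}` whose dual class `Ψ(Sh c)` is locally orthogonal to everything at `v`: there is `y ∈ H¹(U, X)`, unramified off `S₀ ∪ {v}`, with `loc_w (Sh_U y) = t_w` for all `w ∈ S₀`.
References: [MilneADT2006] I Thm. 2.6, Thm. 4.10 (b); [Howard2004HeegnerKolyvagin] Def. 2.1.6, 2.1.10, Thm. 2.1.11; [NeukirchSchmidtWingberg2008] I §6 (1.6.4), (8.6.2)–(8.6.3);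
[Rubin2000] Thm. 1.7.3; [Kobayashi2003] Thm. 7.3 i).
-/

set_option autoImplicit false
set_option linter.dupNamespace false -- D-0017: single-problem summit, the namespace repeats the problem name by design
noncomputable section

open scoped Classical
open CategoryTheory Function NumberField IsDedekindDomain Field

namespace Summit.BirchSwinnertonDyer.BirchSwinnertonDyer.Theorems.SmallImageRttD2Seq

open Literature.NumberTheory.GaloisRepresentations Literature.NumberTheory.GaloisCohomology Literature.NumberTheory.EllipticCurves
open Literature.NumberTheory.GaloisRepresentations.DiscreteGaloisModule
open Literature.NumberTheory.GaloisCohomology.PoitouTateFinite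

section SemilocPT

variable (K : Type) [Field K] [NumberField K] (n : ℕ) [NeZero n]
variable {MX MA : Type} [AddCommGroup MX] [TopologicalSpace MX] [DiscreteTopology MX] [Finite MX]
  [AddCommGroup MA] [TopologicalSpace MA] [DiscreteTopology MA]
  (ρX : DiscreteGaloisModule K MX) (ρA : DiscreteGaloisModule K MA) (B : MX →+ MA →+ MuCarrier K n)
  (hB : ∀ (σ : absoluteGaloisGroup K) (x : MX) (a : MA), B (ρX σ x) (ρA σ a) = mu K n σ (B x a))
  (U : Subgroup (absoluteGaloisGroup K)) (hU : IsOpen (U : Set (absoluteGaloisGroup K))) [Fintype (absoluteGaloisGroup K ⧸ U)]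

set_option maxHeartbeats 400000 in
/-- ★★★ **Poitou–Tate EXISTENCE at the depleted places for the coinduced module.** Let `v` be a finite place, `S₀` a finite set of finite places with `v ∉ S₀`, such that every
place dividing `n` lies in `S₀ ∪ {v}` and `Maps(Γ_K ⧸ U, X)` is unramified off `S₀ ∪ {v}`. Let `t_w ∈ H¹(K_w, Maps(Γ_K ⧸ U, X))` (`w ∈ S₀`) satisfy
`Σ_{w∈S₀} ⟨t_w, loc_w(Ψ(Sh_U c))⟩_w = 0` for every `c ∈ H¹(U, A)` that is unramified off `S₀ ∪ {v}` (zero on `U ⊓ I_𝔓`) and whose dual class is orthogonal to all of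
`H¹(K_v, Maps(Γ_K ⧸ U, X))` at `v` (`Ψ = coindTateDualMor`, `⟨·,·⟩_w` THE canonical local Tate pairing). Then there is `y ∈ H¹(U, X)`, unramified off `S₀ ∪ {v}`, with
`loc_w(Sh_U y) = t_w` for every `w ∈ S₀`. (Selmer structures `𝓕 = (0 at S₀, all at v) ≤ 𝓖 = (all at S₀ ∪ {v})`, unramified elsewhere; `SelmerComplement` (i) for THE canonical maps;
`H¹_{𝓕*} ∋ Y = Ψ(Sh c)` with `c` unramified off `S₀ ∪ {v}` by Milne I 2.6 for THE maps.) [cite: MilneADT2006, Ch. I, Thm. 2.6, Thm. 4.10(b)] [cite: Howard2004HeegnerKolyvagin, Thm. 2.1.11]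
[cite: NeukirchSchmidtWingberg2008, I §6 Prop. (1.6.4), (8.6.2)–(8.6.3)] -/
theorem exists_layer_forall_localization_shapiroLift_eq (hBbij : Bijective fun a : MA ↦ B.flip a) (hMn : ∀ x : MX, n • x = 0)
    {s : absoluteGaloisGroup K ⧸ U → absoluteGaloisGroup K} (hs : ∀ y, (s y : absoluteGaloisGroup K ⧸ U) = y)
    (hs1 : s ((1 : absoluteGaloisGroup K) : absoluteGaloisGroup K ⧸ U) = 1)
    (v : HeightOneSpectrum (𝓞 K)) (S₀ : Finset (HeightOneSpectrum (𝓞 K))) (hvS₀ : v ∉ S₀)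
    (hn : ∀ w : HeightOneSpectrum (𝓞 K), ((n : ℕ) : 𝓞 K) ∈ w.asIdeal → w ∈ insert v S₀)
    (hur : ∀ w : HeightOneSpectrum (𝓞 K), w ∉ insert v S₀ → GaloisRep.IsUnramifiedAt w (ρX.coind U hU))
    (t : ∀ w : HeightOneSpectrum (𝓞 K), galoisCohomology ((ρX.coind U hU).toLocal (Sum.inr w)) 1)
    (ht : ∀ c : continuousCohomology 1 (subgroupRep ρA.toTopRep U),
      (∀ w : HeightOneSpectrum (𝓞 K), w ∉ insert v S₀ → ∀ 𝔓 ∈ w.primesAbove,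
        resLe ρA.toTopRep (inf_le_left : U ⊓ 𝔓.inertia (absoluteGaloisGroup K) ≤ U) 1 c = 0) →
      (∀ a : galoisCohomology ((ρX.coind U hU).toLocal (Sum.inr v)) 1,
        localTatePairingZMod (ρX.coind U hU) n (Sum.inr v) (LocalInvariants.canonical K n (Sum.inr v)) a
          (galoisCohomology.localization ((ρX.coind U hU).tateDual n) (Sum.inr v) 1
            (cohomologyMap (coindTateDualMor ρX ρA U B hU hB) 1 (shapiroLift ρA.toTopRep U hU hs hs1 c))) = 0) →
      ∑ w ∈ S₀, localTatePairingZMod (ρX.coind U hU) n (Sum.inr w) (LocalInvariants.canonical K n (Sum.inr w)) (t w)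
        (galoisCohomology.localization ((ρX.coind U hU).tateDual n) (Sum.inr w) 1
          (cohomologyMap (coindTateDualMor ρX ρA U B hU hB) 1 (shapiroLift ρA.toTopRep U hU hs hs1 c))) = 0) :
    ∃ y : continuousCohomology 1 (subgroupRep ρX.toTopRep U),
      (∀ w ∈ S₀, galoisCohomology.localization (ρX.coind U hU) (Sum.inr w) 1 (shapiroLift ρX.toTopRep U hU hs hs1 y) = t w) ∧
      (∀ w : HeightOneSpectrum (𝓞 K), w ∉ insert v S₀ → ∀ 𝔓 ∈ w.primesAbove,
        resLe ρX.toTopRep (inf_le_left : U ⊓ 𝔓.inertia (absoluteGaloisGroup K) ≤ U) 1 y = 0) := by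
  haveI : CompactSpace (absoluteGaloisGroup K) := absoluteGaloisGroup_compactSpace K
  -- ### the set of places `S = ∞ ∪ {v} ∪ S₀`
  set S : Finset (Place K) := (Finset.univ : Finset (InfinitePlace K)).image Sum.inl ∪ (insert v S₀).image Sum.inr with hSdef
  have hSinl : ∀ w : InfinitePlace K, (Sum.inl w : Place K) ∈ S := fun w ↦
    Finset.mem_union_left _ (Finset.mem_image_of_mem _ (Finset.mem_univ w))
  have hSinr : ∀ w : HeightOneSpectrum (𝓞 K), (Sum.inr w : Place K) ∈ S ↔ w ∈ insert v S₀ := by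
    intro w
    constructor
    · intro h
      rcases Finset.mem_union.mp h with h | h
      · obtain ⟨w', -, hw'⟩ := Finset.mem_image.mp h
        exact absurd hw' Sum.inl_ne_inr
      · obtain ⟨w', hw', heq⟩ := Finset.mem_image.mp h
        rw [← Sum.inr_injective heq]
        exact hw'
    · exact fun h ↦ Finset.mem_union_right _ (Finset.mem_image_of_mem _ h)
  have hvS : (Sum.inr v : Place K) ∈ S := (hSinr v).mpr (Finset.mem_insert_self _ _)
  have hS' : ∀ u : HeightOneSpectrum (𝓞 K), (Sum.inr u : Place K) ∉ S →
      ((n : ℕ) : 𝓞 K) ∉ u.asIdeal ∧ GaloisRep.IsUnramifiedAt u (ρX.coind U hU) := fun u hu ↦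
    have hu' : u ∉ insert v S₀ := fun h ↦ hu ((hSinr u).mpr h)
    ⟨fun h ↦ hu' (hn u h), hur u hu'⟩
  have hM : ∀ φ : absoluteGaloisGroup K ⧸ U → MX, n • φ = 0 := fun φ ↦ funext fun y ↦ by
    rw [Pi.smul_apply, Pi.zero_apply]; exact hMn (φ y)
  -- ### the Selmer structures `𝓕 ≤ 𝓖` on `Maps(Γ_K ⧸ U, X)`
  let 𝓖 : SelmerStructure (ρX.coind U hU) := fun w ↦ match w with
    | Sum.inl _ => ⊤
    | Sum.inr u => if u ∈ insert v S₀ then ⊤ else unramifiedSubgroup (GaloisRep.toLocal u (ρX.coind U hU)) 1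
  let 𝓕 : SelmerStructure (ρX.coind U hU) := fun w ↦ match w with
    | Sum.inl _ => ⊤
    | Sum.inr u => if u = v then ⊤ else if u ∈ S₀ then ⊥ else unramifiedSubgroup (GaloisRep.toLocal u (ρX.coind U hU)) 1
  have h𝓖S : ∀ u ∈ insert v S₀, 𝓖 (Sum.inr u) = ⊤ := fun u hu ↦ by
    change (if u ∈ insert v S₀ then ⊤ else unramifiedSubgroup (GaloisRep.toLocal u (ρX.coind U hU)) 1) = ⊤
    rw [if_pos hu]
  have h𝓖nS : ∀ u : HeightOneSpectrum (𝓞 K), u ∉ insert v S₀ → 𝓖 (Sum.inr u) = unramifiedSubgroup (GaloisRep.toLocal u (ρX.coind U hU)) 1 := fun u hu ↦ by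
    change (if u ∈ insert v S₀ then ⊤ else unramifiedSubgroup (GaloisRep.toLocal u (ρX.coind U hU)) 1) = _
    rw [if_neg hu]
  have h𝓕v : 𝓕 (Sum.inr v) = ⊤ := by
    change (if v = v then ⊤ else if v ∈ S₀ then ⊥ else unramifiedSubgroup (GaloisRep.toLocal v (ρX.coind U hU)) 1) = ⊤
    rw [if_pos rfl]
  have h𝓕S₀ : ∀ u ∈ S₀, 𝓕 (Sum.inr u) = ⊥ := fun u hu ↦ by
    have hne : u ≠ v := fun h ↦ hvS₀ (h ▸ hu)
    change (if u = v then ⊤ else if u ∈ S₀ then ⊥ else unramifiedSubgroup (GaloisRep.toLocal u (ρX.coind U hU)) 1) = ⊥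
    rw [if_neg hne, if_pos hu]
  have h𝓕nS : ∀ u : HeightOneSpectrum (𝓞 K), u ∉ insert v S₀ → 𝓕 (Sum.inr u) = unramifiedSubgroup (GaloisRep.toLocal u (ρX.coind U hU)) 1 := fun u hu ↦ by
    have hne : u ≠ v := fun h ↦ hu (h ▸ Finset.mem_insert_self _ _)
    have hu' : u ∉ S₀ := fun h ↦ hu (Finset.mem_insert_of_mem h)
    change (if u = v then ⊤ else if u ∈ S₀ then ⊥ else unramifiedSubgroup (GaloisRep.toLocal u (ρX.coind U hU)) 1) = _
    rw [if_neg hne, if_neg hu']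
  have hle : 𝓕 ≤ 𝓖 := by
    intro w
    rcases w with w | u
    · exact le_rfl
    · by_cases hu : u ∈ insert v S₀
      · rw [h𝓖S u hu]; exact le_top
      · rw [h𝓕nS u hu, h𝓖nS u hu]
  have h𝓖ur : 𝓖.IsUnramifiedOutside S := ⟨hSinl, fun u hu ↦ h𝓖nS u fun h ↦ hu ((hSinr u).mpr h)⟩
  have h𝓕ur : 𝓕.IsUnramifiedOutside S := ⟨hSinl, fun u hu ↦ h𝓕nS u fun h ↦ hu ((hSinr u).mpr h)⟩
  -- ### the local data `T` (zero at `∞` and at `v`)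
  let T : ∀ w : Place K, galoisCohomology ((ρX.coind U hU).toLocal w) 1 := fun w ↦ match w with
    | Sum.inl _ => 0
    | Sum.inr u => if u ∈ S₀ then t u else 0
  have hTinl : ∀ w : InfinitePlace K, T (Sum.inl w) = 0 := fun _ ↦ rfl
  have hTS₀ : ∀ u ∈ S₀, T (Sum.inr u) = t u := fun u hu ↦ by
    change (if u ∈ S₀ then t u else 0) = t u
    rw [if_pos hu]
  have hTnS₀ : ∀ u : HeightOneSpectrum (𝓞 K), u ∉ S₀ → T (Sum.inr u) = 0 := fun u hu ↦ by
    change (if u ∈ S₀ then t u else 0) = 0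
    rw [if_neg hu]
  have hT𝓖 : ∀ w ∈ S, T w ∈ 𝓖 w := by
    intro w hw
    rcases w with w | u
    · exact AddSubgroup.mem_top _
    · rw [h𝓖S u ((hSinr u).mp hw)]; exact AddSubgroup.mem_top _
  -- ### orthogonality against `H¹_{𝓕*}`: every dual Selmer class is `Ψ(Sh c)` with `c` admissible
  have hΨbij : Bijective (coindTateDualMor ρX ρA U B hU hB).hom := coindTateDualHom_bijective U B hBbij
  have horth : ∀ Y ∈ ((LocalInvariants.canonical K n).dualSelmerStructure (ρX.coind U hU) 𝓕).selmerGroup,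
      ∑ w ∈ S, localTatePairingZMod (ρX.coind U hU) n w (LocalInvariants.canonical K n w) (T w)
        (galoisCohomology.localization ((ρX.coind U hU).tateDual n) w 1 Y) = 0 := by
    intro Y hY
    have hYloc := (SelmerStructure.mem_selmerGroup_iff _ _).mp hY
    -- `Y = H¹(Ψ)(Sh_U c)`
    obtain ⟨c, hc⟩ : ∃ c : continuousCohomology 1 (subgroupRep ρA.toTopRep U),
        cohomologyMap (coindTateDualMor ρX ρA U B hU hB) 1 (shapiroLift ρA.toTopRep U hU hs hs1 c) = Y := by
      haveI : DiscreteTopology (coindFin.{0, 0} ρA.toTopRep U) := inferInstanceAs (DiscreteTopology (absoluteGaloisGroup K ⧸ U → MA))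
      obtain ⟨Z, hZ⟩ := (bijective_cohomologyMap_of_bijective_of_discrete (coindTateDualMor ρX ρA U B hU hB) hΨbij 1).2 Y
      obtain ⟨c, hc⟩ := shapiroLift_surjective ρA.toTopRep U hU hs hs1 Z
      exact ⟨c, by rw [hc, hZ]⟩
    -- `c` is unramified off `S₀ ∪ {v}` (Milne I 2.6 for THE maps, transported through `Ψ ∘ Sh`)
    have hcur : ∀ w : HeightOneSpectrum (𝓞 K), w ∉ insert v S₀ → ∀ 𝔓 ∈ w.primesAbove,
        resLe ρA.toTopRep (inf_le_left : U ⊓ 𝔓.inertia (absoluteGaloisGroup K) ≤ U) 1 c = 0 := by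
      intro w hw 𝔓 h𝔓
      have hwS : (Sum.inr w : Place K) ∉ S := fun h ↦ hw ((hSinr w).mp h)
      have h1 := hYloc (Sum.inr w)
      rw [LocalInvariants.dualSelmerStructure_apply, h𝓕nS w hw,
        (PoitouTateReduction.unramifiedOrthogonal_of_isPerfect_allLevels (LocalInvariants.canonical K n) LocalInvariants.canonical_isPerfect
          _ hM w (hS' w hwS).1 (hS' w hwS).2).1] at h1
      obtain ⟨f, rfl⟩ := oneCocycleClass_surjective _ c
      rw [← hc, shapiroLift_oneCocycleClass, cohomologyMap_oneCocycleClass] at h1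
      have hF := GaloisImage.SelmerFinite.apply_eq_zero_of_mem_inertia_of_localization_mem ((ρX.coind U hU).tateDual n)
        (isUnramifiedAt_tateDual_of_not_mem (ρX.coind U hU) (hS' w hwS).1 (hS' w hwS).2) _ h1 𝔓 h𝔓
      rw [resLe_oneCocycleClass, oneCocycleClass_eq_zero_iff]
      refine ⟨0, fun g ↦ ?_⟩
      rw [map_zero, sub_zero, contOneCocycles.pullback_apply, TopRep.hom_ofHom]
      change f.1 (subgroupInclusion (inf_le_left : U ⊓ 𝔓.inertia (absoluteGaloisGroup K) ≤ U) g) = 0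
      have hg : subgroupInclusion (inf_le_left : U ⊓ 𝔓.inertia (absoluteGaloisGroup K) ≤ U) g =
          ⟨(g : absoluteGaloisGroup K), g.2.1⟩ := Subtype.ext (subgroupInclusion_apply_coe _ g)
      rw [hg]
      refine SignedLowerOffTwo.PTDeep.apply_eq_zero_of_shapiroCocycle_apply_eq_zero ρA U hU hs hs1 f g.2.1 ?_
      have h2 := hF (g : absoluteGaloisGroup K) g.2.2
      rw [contOneCocycles.pullback_apply, resIdHom_hom_apply, coindTateDualMor_hom_apply] at h2
      exact coindTateDualHom_injective U B hBbij.1 (h2.trans (map_zero _).symm)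
    -- `loc_v Y` is orthogonal to everything at `v` (`𝓕_v = ⊤`)
    have hcv : ∀ a : galoisCohomology ((ρX.coind U hU).toLocal (Sum.inr v)) 1,
        localTatePairingZMod (ρX.coind U hU) n (Sum.inr v) (LocalInvariants.canonical K n (Sum.inr v)) a
          (galoisCohomology.localization ((ρX.coind U hU).tateDual n) (Sum.inr v) 1
            (cohomologyMap (coindTateDualMor ρX ρA U B hU hB) 1 (shapiroLift ρA.toTopRep U hU hs hs1 c))) = 0 := by
      intro a
      have h1 := hYloc (Sum.inr v)
      rw [LocalInvariants.dualSelmerStructure_apply, LocalInvariants.mem_dualLocalCondition_iff, h𝓕v] at h1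
      rw [hc]
      exact h1 a (AddSubgroup.mem_top a)
    -- the sum over `S` reduces to the sum over `S₀`
    have hsum : ∑ w ∈ S, localTatePairingZMod (ρX.coind U hU) n w (LocalInvariants.canonical K n w) (T w)
        (galoisCohomology.localization ((ρX.coind U hU).tateDual n) w 1 Y) =
        ∑ u ∈ S₀, localTatePairingZMod (ρX.coind U hU) n (Sum.inr u) (LocalInvariants.canonical K n (Sum.inr u)) (t u)
          (galoisCohomology.localization ((ρX.coind U hU).tateDual n) (Sum.inr u) 1 Y) := by
      rw [hSdef, Finset.sum_union (Finset.disjoint_left.mpr fun w h1 h2 ↦ by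
        obtain ⟨a, -, rfl⟩ := Finset.mem_image.mp h1
        obtain ⟨b, -, hb⟩ := Finset.mem_image.mp h2
        exact Sum.inr_ne_inl hb)]
      rw [Finset.sum_image (fun a _ b _ h ↦ Sum.inl_injective h), Finset.sum_image (fun a _ b _ h ↦ Sum.inr_injective h)]
      rw [Finset.sum_eq_zero (fun w _ ↦ by rw [hTinl, map_zero, AddMonoidHom.zero_apply]), zero_add, Finset.sum_insert hvS₀, hTnS₀ v hvS₀, map_zero,
        AddMonoidHom.zero_apply, zero_add]
      exact Finset.sum_congr rfl fun u hu ↦ by rw [hTS₀ u hu]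
    rw [hsum, ← hc]
    exact ht c hcur hcv
  -- ### Milne I 4.10 (b) `⊇` for THE canonical maps, clause (i)
  obtain ⟨x, hx𝓖, hxT⟩ :=
    ((PoitouTateReduction.selmerComplement_canonical_holds K n) (ρX.coind U hU) hM S hS' 𝓕 𝓖 hle h𝓕ur h𝓖ur).1 T hT𝓖 horth
  obtain ⟨y, rfl⟩ := shapiroLift_surjective ρX.toTopRep U hU hs hs1 x
  have hxloc := (SelmerStructure.mem_selmerGroup_iff _ _).mp hx𝓖
  refine ⟨y, fun w hw ↦ ?_, fun w hw 𝔓 h𝔓 ↦ ?_⟩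
  · -- prescribed values at `S₀`
    have h1 := hxT (Sum.inr w) ((hSinr w).mpr (Finset.mem_insert_of_mem hw))
    rw [h𝓕S₀ w hw, AddSubgroup.mem_bot, sub_eq_zero, hTS₀ w hw] at h1
    exact h1
  · -- unramified off `S₀ ∪ {v}`
    have h1 := hxloc (Sum.inr w)
    rw [h𝓖nS w hw] at h1
    exact SignedLowerOffTwo.PTDeep.resLe_inertia_eq_zero_of_localization_shapiroLift_mem ρX U hU hs hs1 (hur w hw) y h1 h𝔓

end SemilocPT

end Summit.BirchSwinnertonDyer.BirchSwinnertonDyer.Theorems.SmallImageRttD2Seq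

end
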